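import Summits.NavierStokesRegularity.NavierStokesRegularity.Theorems.ExtremiserTransienceNearExtremalTransienceExtremiserLiouvilleConstantSpeedJetCauchyStep
import Summits.NavierStokesRegularity.NavierStokesRegularity.Theorems.ExtremiserTransienceNearExtremalTransienceExtremiserLiouvilleConstantSpeedEnergyFluxInvariance
import Summits.NavierStokesRegularity.NavierStokesRegularity.Theorems.ExtremiserTransienceNearExtremalTransienceExtremiserLiouvilleConstantSpeedAxialPairingL6
import HarnessLib

/-!
# Crux `ExtremiserTransience.NearExtremalTransience` (stmt-NavierStokesRegularity-21883), line `extremiser_liouville`,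
# stub K1b — THE JET ENDGAME: a jet whose window Dirichlet energies are summably small does not exist

`--supports stmt-NavierStokesRegularity-21883` (helper).  Author: prover seat `ns-el-k1b` (g8).  Record:
`Cruxes/NearExtremalTransience/Lines/extremiser_liouville_k1b_slide.md` §5.  Tools (window weight `H′(x₂ − s)`):
`integral_window_translate` (`∫H′(x₂−s)g(x+ae₂) = ∫H′(x₂−(s+a))g`), `abs_integral_window_inner_le` (weighted Young),
`integral_window_norm_sub_translate_sq_le` (real form of `…JetCauchyStep`).  Main theorem
`windowEnergy_nonpos_of_windowDirichlet_decay`: **a bounded `C¹` field `V → 0` at infinity with square-integrable slabs,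
`∂₂V ∈ L²`, constant window energies `∫H′(x₂−s)‖V‖² = E₀` and summably small window Dirichlet energies of `∂₂V` far up has
`E₀ ≤ 0`** — `E₀ = ∫H′_{s₀}⟪V, V − V(·+Ne₂)⟫ + ∫H′_{s₀}⟪V, V(·+Ne₂)⟫`, the first term telescopes through the unit steps, the second is
small by uniform decay on a ball and the `L¹` tail off it.  For the K1b residue JET (`E₀ > 0`) this is the last step of the
Piola-slide kill once (DEC) of the record is available.
WHAT THIS IS NOT: K1b is NOT proved; nothing here proves NS regularity. [folklore]
-/

noncomputable section

open Set Filter Topology MeasureTheory Metric Function InnerProductSpace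
open scoped ENNReal NNReal Topology InnerProductSpace RealInnerProductSpace ContDiff

namespace Summit.NavierStokesRegularity.NavierStokesRegularity.Theorems

-- the problem directory repeats the summit name (`NavierStokesRegularity/NavierStokesRegularity`)
set_option linter.dupNamespace false

namespace ExtremiserLiouville

variable {V A B : EuclideanSpace ℝ (Fin 3) → EuclideanSpace ℝ (Fin 3)}

/-! ## 1. Tools -/

/-- **Translation of window integrals**: `∫H′(x₂−s)·g(x + a e₂) = ∫H′(x₂−(s+a))·g(x)`. [folklore] -/
theorem integral_window_translate (g : EuclideanSpace ℝ (Fin 3) → ℝ) (s a : ℝ) :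
    (∫ x : EuclideanSpace ℝ (Fin 3), deriv Real.smoothTransition (x 2 - s) * g (x + a • EuclideanSpace.single (2 : Fin 3) (1 : ℝ))) =
      ∫ x : EuclideanSpace ℝ (Fin 3), deriv Real.smoothTransition (x 2 - (s + a)) * g x := by
  have h := integral_add_right_eq_self (μ := (volume : Measure (EuclideanSpace ℝ (Fin 3))))
    (fun y : EuclideanSpace ℝ (Fin 3) => deriv Real.smoothTransition (y 2 - (s + a)) * g y)
    (a • EuclideanSpace.single (2 : Fin 3) (1 : ℝ))
  rw [← h]
  refine integral_congr_ae (Eventually.of_forall fun x => ?_)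
  dsimp only
  congr 2
  simp only [PiLp.add_apply, PiLp.smul_apply, smul_eq_mul]
  simp

/-- **Weighted Young inequality**: `|∫H′⟪A,B⟫| ≤ (μ/2)∫H′‖A‖² + (1/2μ)∫H′‖B‖²` (`μ > 0`; the three densities integrable).
[folklore] -/
theorem abs_integral_window_inner_le {w : EuclideanSpace ℝ (Fin 3) → ℝ} (hw : ∀ x, 0 ≤ w x) {μ : ℝ} (hμ : 0 < μ)
    (iA : Integrable (fun x => w x * ‖A x‖ ^ 2) volume) (iB : Integrable (fun x => w x * ‖B x‖ ^ 2) volume)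
    (iAB : Integrable (fun x => w x * ⟪A x, B x⟫) volume) :
    |∫ x, w x * ⟪A x, B x⟫| ≤ μ / 2 * (∫ x, w x * ‖A x‖ ^ 2) + 1 / (2 * μ) * ∫ x, w x * ‖B x‖ ^ 2 := by
  rw [← integral_const_mul, ← integral_const_mul, ← integral_add (iA.const_mul _) (iB.const_mul _)]
  have hpt : ∀ x, |w x * ⟪A x, B x⟫| ≤ μ / 2 * (w x * ‖A x‖ ^ 2) + 1 / (2 * μ) * (w x * ‖B x‖ ^ 2) := by
    intro x
    rw [abs_mul, abs_of_nonneg (hw x)]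
    have h1 : |⟪A x, B x⟫| ≤ ‖A x‖ * ‖B x‖ := abs_real_inner_le_norm _ _
    have h2 : ‖A x‖ * ‖B x‖ ≤ μ / 2 * ‖A x‖ ^ 2 + 1 / (2 * μ) * ‖B x‖ ^ 2 := by
      have hμ' : 0 < 2 * μ := by positivity
      have key : 0 ≤ (μ * ‖A x‖ - ‖B x‖) ^ 2 / (2 * μ) := div_nonneg (sq_nonneg _) hμ'.le
      have e : μ / 2 * ‖A x‖ ^ 2 + 1 / (2 * μ) * ‖B x‖ ^ 2 - ‖A x‖ * ‖B x‖ = (μ * ‖A x‖ - ‖B x‖) ^ 2 / (2 * μ) := by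
        field_simp
        ring
      linarith
    calc w x * |⟪A x, B x⟫| ≤ w x * (μ / 2 * ‖A x‖ ^ 2 + 1 / (2 * μ) * ‖B x‖ ^ 2) :=
          mul_le_mul_of_nonneg_left (h1.trans h2) (hw x)
      _ = μ / 2 * (w x * ‖A x‖ ^ 2) + 1 / (2 * μ) * (w x * ‖B x‖ ^ 2) := by ring
  refine (abs_integral_le_integral_abs).trans (integral_mono iAB.abs ((iA.const_mul _).add (iB.const_mul _)) hpt)

/-- **Real form of the Cauchy step**: if `∫H′(y₂ − (r+t))‖∂₂V(y)‖²dy ≤ a²` for all `t ∈ [0,1]` then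
`∫H′(x₂−r)‖V(x+e₂) − V(x)‖² ≤ a²` (`V ∈ C¹`, `∂₂V ∈ L²`, slabs square integrable). [folklore] -/
theorem integral_window_norm_sub_translate_sq_le (hV : ContDiff ℝ 1 V)
    (hD2 : Integrable (fun x => ‖fderiv ℝ V x (EuclideanSpace.single (2 : Fin 3) (1 : ℝ))‖ ^ 2) volume)
    (hslab : ∀ T : ℝ, 0 < T →
      Integrable (fun x => {x : EuclideanSpace ℝ (Fin 3) | |x 2| ≤ T}.indicator (fun x => ‖V x‖ ^ 2) x) volume)
    {r a : ℝ} (ha : ∀ t ∈ Icc (0 : ℝ) 1,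
      (∫ y, deriv Real.smoothTransition (y 2 - (r + t)) * ‖fderiv ℝ V y (EuclideanSpace.single (2 : Fin 3) (1 : ℝ))‖ ^ 2) ≤ a ^ 2) :
    (∫ x, deriv Real.smoothTransition (x 2 - r) *
        ‖V (x + EuclideanSpace.single (2 : Fin 3) (1 : ℝ)) - V x‖ ^ 2) ≤ a ^ 2 := by
  set e₂ : EuclideanSpace ℝ (Fin 3) := EuclideanSpace.single (2 : Fin 3) (1 : ℝ) with he₂
  obtain ⟨D, hD0, hD⟩ := Literature.Analysis.Calculus.exists_bound_deriv_smoothTransition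
  have hH0 : ∀ u, 0 ≤ deriv Real.smoothTransition u := fun u => Real.smoothTransition.monotone.deriv_nonneg
  have cH : Continuous (deriv Real.smoothTransition) := (Real.smoothTransition.contDiff (n := 1)).continuous_deriv le_rfl
  set ρ : EuclideanSpace ℝ (Fin 3) → ℝ := fun x => deriv Real.smoothTransition (x 2 - r) with hρ
  have cρ : Continuous ρ := cH.comp ((PiLp.continuous_apply 2 _ (2 : Fin 3)).sub continuous_const)
  have hρ0 : ∀ x, 0 ≤ ρ x := fun x => hH0 _
  -- the translated window Dirichlet energies, as lintegrals
  have cD : Continuous fun y => fderiv ℝ V y e₂ := (hV.continuous_fderiv one_ne_zero).clm_apply continuous_const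
  have iDt : ∀ t : ℝ, Integrable (fun y => ρ (y - t • e₂) * ‖fderiv ℝ V y e₂‖ ^ 2) volume := by
    intro t
    refine (hD2.const_mul D).mono' ((cρ.comp (continuous_id.sub continuous_const)).mul (cD.norm.pow 2)).aestronglyMeasurable
      (Eventually.of_forall fun y => ?_)
    rw [Real.norm_eq_abs, abs_mul, abs_of_nonneg (sq_nonneg ‖fderiv ℝ V y e₂‖)]
    exact mul_le_mul_of_nonneg_right (by rw [abs_of_nonneg (hρ0 _)]; exact (le_abs_self _).trans (hD _)) (sq_nonneg _)
  have hρt : ∀ t y, ρ (y - t • e₂) = deriv Real.smoothTransition (y 2 - (r + t)) := by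
    intro t y
    simp only [hρ, he₂, PiLp.sub_apply, PiLp.smul_apply, smul_eq_mul]
    congr 1; simp; ring
  have hδ : ∀ t ∈ Ioc (0 : ℝ) 1, (∫⁻ y, ENNReal.ofReal (ρ (y - t • e₂) * ‖fderiv ℝ V y e₂‖ ^ 2)) ≤ ENNReal.ofReal (a ^ 2) := by
    intro t ht
    rw [← ofReal_integral_eq_lintegral_ofReal (iDt t) (Eventually.of_forall fun y => mul_nonneg (hρ0 _) (sq_nonneg _))]
    refine ENNReal.ofReal_le_ofReal ?_
    have e : (fun y => ρ (y - t • e₂) * ‖fderiv ℝ V y e₂‖ ^ 2) =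
        fun y => deriv Real.smoothTransition (y 2 - (r + t)) * ‖fderiv ℝ V y e₂‖ ^ 2 := by
      funext y; rw [hρt]
    rw [e]; exact ha t ⟨ht.1.le, ht.2⟩
  have hmain := lintegral_weight_norm_sub_translate_sq_le_of_le hV cρ hρ0 hδ
  -- back to a real integral
  have cV : Continuous V := hV.continuous
  have iL : Integrable (fun x => ρ x * ‖V (x + e₂) - V x‖ ^ 2) volume := by
    have i0 : Integrable (fun x => deriv Real.smoothTransition (x 2 - r) * ‖V x‖ ^ 2) volume :=
      integrable_deriv_smoothTransition_mul_sq cV (le_refl (|r| + 1)) (hslab _ (by positivity))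
    have i1 : Integrable (fun x => deriv Real.smoothTransition (x 2 - r) * ‖V (x + e₂)‖ ^ 2) volume := by
      have i1' : Integrable (fun x => deriv Real.smoothTransition (x 2 - (r + 1)) * ‖V x‖ ^ 2) volume :=
        integrable_deriv_smoothTransition_mul_sq cV (le_refl (|r + 1| + 1)) (hslab _ (by positivity))
      have h := i1'.comp_add_right e₂
      refine h.congr (Eventually.of_forall fun x => ?_)
      dsimp only
      congr 2
      simp only [he₂, PiLp.add_apply]; simp
    have cdiff : Continuous fun x => ‖V (x + e₂) - V x‖ ^ 2 := ((cV.comp (continuous_id.add continuous_const)).sub cV).norm.pow 2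
    have i01 : Integrable (fun x => 2 * (deriv Real.smoothTransition (x 2 - r) * ‖V x‖ ^ 2 +
        deriv Real.smoothTransition (x 2 - r) * ‖V (x + e₂)‖ ^ 2)) volume := (i0.add i1).const_mul 2
    refine i01.mono' (cρ.mul cdiff).aestronglyMeasurable (Eventually.of_forall fun x => ?_)
    rw [Real.norm_eq_abs, abs_mul, abs_of_nonneg (hρ0 x), abs_of_nonneg (sq_nonneg _)]
    dsimp only
    have hns : ‖V (x + e₂) - V x‖ ^ 2 ≤ 2 * (‖V x‖ ^ 2 + ‖V (x + e₂)‖ ^ 2) := by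
      have h1 : ‖V (x + e₂) - V x‖ * ‖V (x + e₂) - V x‖ ≤ (‖V (x + e₂)‖ + ‖V x‖) * (‖V (x + e₂)‖ + ‖V x‖) :=
        mul_self_le_mul_self (norm_nonneg _) (norm_sub_le _ _)
      nlinarith [h1, sq_nonneg (‖V x‖ - ‖V (x + e₂)‖)]
    calc ρ x * ‖V (x + e₂) - V x‖ ^ 2 ≤ ρ x * (2 * (‖V x‖ ^ 2 + ‖V (x + e₂)‖ ^ 2)) := mul_le_mul_of_nonneg_left hns (hρ0 x)
      _ = 2 * (deriv Real.smoothTransition (x 2 - r) * ‖V x‖ ^ 2 + deriv Real.smoothTransition (x 2 - r) * ‖V (x + e₂)‖ ^ 2) := by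
          simp only [hρ]; ring
  have hnn : 0 ≤ a ^ 2 := sq_nonneg a
  rw [integral_eq_lintegral_of_nonneg_ae (Eventually.of_forall fun x => mul_nonneg (hρ0 x) (sq_nonneg _)) iL.aestronglyMeasurable]
  exact ENNReal.toReal_le_of_le_ofReal hnn hmain

/-! ## 2. The endgame -/

/-- **THE JET ENDGAME.**  A bounded `C¹` field `V` on `ℝ³` with `V → 0` at infinity, all slabs `{|x₂| ≤ T}` square integrable,
`∂₂V ∈ L²`, constant window energies `∫H′(x₂−s)‖V‖² = E₀` and window Dirichlet energies of `∂₂V` summably small far up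
(`∀ε>0 ∃s₀ ∃a ≥ 0` summable with `Σa ≤ ε` and `∫H′(y₂−(s₀+k+t))‖∂₂V‖² ≤ a_k²` for `k ∈ ℕ`, `t ∈ [0,1]`) has `E₀ ≤ 0`.
In particular the residue JET (`E₀ > 0`) with (DEC) does not exist. [folklore] -/
theorem windowEnergy_nonpos_of_windowDirichlet_decay (hV : ContDiff ℝ 1 V) {Cv : ℝ} (hVb : ∀ x, ‖V x‖ ≤ Cv)
    (hfar : Tendsto V (cocompact (EuclideanSpace ℝ (Fin 3))) (𝓝 0))
    (hslab : ∀ T : ℝ, 0 < T →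
      Integrable (fun x => {x : EuclideanSpace ℝ (Fin 3) | |x 2| ≤ T}.indicator (fun x => ‖V x‖ ^ 2) x) volume)
    (hD2 : Integrable (fun x => ‖fderiv ℝ V x (EuclideanSpace.single (2 : Fin 3) (1 : ℝ))‖ ^ 2) volume)
    {E₀ : ℝ} (hE : ∀ s : ℝ, (∫ x, deriv Real.smoothTransition (x 2 - s) * ‖V x‖ ^ 2) = E₀)
    (hdec : ∀ ε : ℝ, 0 < ε → ∃ (s₀ : ℝ) (a : ℕ → ℝ), (∀ k, 0 ≤ a k) ∧ Summable a ∧ (∑' k, a k) ≤ ε ∧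
      ∀ (k : ℕ) (t : ℝ), t ∈ Icc (0 : ℝ) 1 →
        (∫ y, deriv Real.smoothTransition (y 2 - (s₀ + k + t)) *
          ‖fderiv ℝ V y (EuclideanSpace.single (2 : Fin 3) (1 : ℝ))‖ ^ 2) ≤ (a k) ^ 2) :
    E₀ ≤ 0 := by
  by_contra hE0'
  have hE0 : 0 < E₀ := lt_of_not_ge hE0'
  set e₂ : EuclideanSpace ℝ (Fin 3) := EuclideanSpace.single (2 : Fin 3) (1 : ℝ) with he₂
  set H' : ℝ → ℝ := deriv Real.smoothTransition with hH'
  obtain ⟨D, hD0, hD⟩ := Literature.Analysis.Calculus.exists_bound_deriv_smoothTransition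
  have hH0 : ∀ u, 0 ≤ H' u := fun u => Real.smoothTransition.monotone.deriv_nonneg
  have hHD : ∀ u, H' u ≤ D := fun u => (le_abs_self _).trans (hD u)
  have cH : Continuous H' := (Real.smoothTransition.contDiff (n := 1)).continuous_deriv le_rfl
  have cV : Continuous V := hV.continuous
  have hCv : 0 ≤ Cv := (norm_nonneg _).trans (hVb 0)
  have hne : ‖e₂‖ = 1 := by rw [he₂, PiLp.norm_single, norm_one]
  obtain ⟨s₀, a, ha0, hsum, htsum, hak⟩ := hdec (E₀ / (4 * (E₀ + 1))) (by positivity)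
  have iW : ∀ b : ℝ, Integrable (fun x => H' (x 2 - s₀) * ‖V (x + b • e₂)‖ ^ 2) volume := by
    intro b
    have i1 : Integrable (fun x => H' (x 2 - (s₀ + b)) * ‖V x‖ ^ 2) volume :=
      integrable_deriv_smoothTransition_mul_sq cV (le_refl (|s₀ + b| + 1)) (hslab _ (by positivity))
    refine (i1.comp_add_right (b • e₂)).congr (Eventually.of_forall fun x => ?_)
    dsimp only
    congr 2
    simp only [he₂, PiLp.add_apply, PiLp.smul_apply, smul_eq_mul]; simp
  have hW : ∀ b : ℝ, (∫ x, H' (x 2 - s₀) * ‖V (x + b • e₂)‖ ^ 2) = E₀ := fun b => by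
    rw [hH', integral_window_translate (fun y => ‖V y‖ ^ 2) s₀ b]; exact hE _
  have cVb : ∀ b : ℝ, Continuous fun x => V (x + b • e₂) := fun b => cV.comp (continuous_id.add continuous_const)
  have cHx : Continuous fun x : EuclideanSpace ℝ (Fin 3) => H' (x 2 - s₀) :=
    cH.comp ((PiLp.continuous_apply 2 _ (2 : Fin 3)).sub continuous_const)
  have iP : ∀ b b' : ℝ, Integrable (fun x => H' (x 2 - s₀) * ⟪V (x + b • e₂), V (x + b' • e₂)⟫) volume := by
    intro b b'
    refine (((iW b).add (iW b')).div_const 2).mono' (cHx.mul ((cVb b).inner (cVb b'))).aestronglyMeasurable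
      (Eventually.of_forall fun x => ?_)
    rw [Real.norm_eq_abs, abs_mul, abs_of_nonneg (hH0 _)]
    dsimp only
    have h1 := abs_real_inner_le_norm (V (x + b • e₂)) (V (x + b' • e₂))
    have h2 : ‖V (x + b • e₂)‖ * ‖V (x + b' • e₂)‖ ≤ (‖V (x + b • e₂)‖ ^ 2 + ‖V (x + b' • e₂)‖ ^ 2) / 2 := by
      nlinarith [sq_nonneg (‖V (x + b • e₂)‖ - ‖V (x + b' • e₂)‖)]
    calc H' (x 2 - s₀) * |⟪V (x + b • e₂), V (x + b' • e₂)⟫| ≤ H' (x 2 - s₀) * ((‖V (x + b • e₂)‖ ^ 2 + ‖V (x + b' • e₂)‖ ^ 2) / 2) :=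
          mul_le_mul_of_nonneg_left (h1.trans h2) (hH0 _)
      _ = (H' (x 2 - s₀) * ‖V (x + b • e₂)‖ ^ 2 + H' (x 2 - s₀) * ‖V (x + b' • e₂)‖ ^ 2) / 2 := by ring
  have hV0 : ∀ x : EuclideanSpace ℝ (Fin 3), V (x + (0 : ℝ) • e₂) = V x := fun x => by rw [zero_smul, add_zero]
  have hstep : ∀ k : ℕ, (∫ x, H' (x 2 - s₀) * ‖V (x + (k : ℝ) • e₂) - V (x + ((k : ℝ) + 1) • e₂)‖ ^ 2) ≤ (a k) ^ 2 := by
    intro k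
    have h := integral_window_norm_sub_translate_sq_le hV hD2 hslab (r := s₀ + k) (a := a k)
      (fun t ht => hak k t ht)
    have e : (fun x : EuclideanSpace ℝ (Fin 3) => H' (x 2 - s₀) * ‖V (x + (k : ℝ) • e₂) - V (x + ((k : ℝ) + 1) • e₂)‖ ^ 2) =
        fun x => H' (x 2 - s₀) * (fun y => ‖V y - V (y + e₂)‖ ^ 2) (x + (k : ℝ) • e₂) := by
      funext x; simp only [add_smul, one_smul, add_assoc]
    rw [e, hH', integral_window_translate (fun y => ‖V y - V (y + e₂)‖ ^ 2) s₀ k]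
    refine le_of_eq_of_le (integral_congr_ae (Eventually.of_forall fun y => ?_)) h
    dsimp only
    rw [norm_sub_rev]
  have hpair : ∀ k : ℕ, |∫ x, H' (x 2 - s₀) * ⟪V x, V (x + (k : ℝ) • e₂) - V (x + ((k : ℝ) + 1) • e₂)⟫| ≤
      a k * (E₀ + 1) / 2 := by
    intro k
    have iA : Integrable (fun x => H' (x 2 - s₀) * ‖V x‖ ^ 2) volume := by
      have := iW 0; simp_rw [hV0] at this; exact this
    have iB : Integrable (fun x => H' (x 2 - s₀) * ‖V (x + (k : ℝ) • e₂) - V (x + ((k : ℝ) + 1) • e₂)‖ ^ 2) volume := by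
      have iS : Integrable (fun x => 2 * (H' (x 2 - s₀) * ‖V (x + (k : ℝ) • e₂)‖ ^ 2 +
          H' (x 2 - s₀) * ‖V (x + ((k : ℝ) + 1) • e₂)‖ ^ 2)) volume := ((iW k).add (iW ((k : ℝ) + 1))).const_mul 2
      refine iS.mono' (cHx.mul (((cVb k).sub (cVb ((k : ℝ) + 1))).norm.pow 2)).aestronglyMeasurable
        (Eventually.of_forall fun x => ?_)
      rw [Real.norm_eq_abs, abs_mul, abs_of_nonneg (hH0 _), abs_of_nonneg (sq_nonneg _)]
      dsimp only
      have h1 : ‖V (x + (k : ℝ) • e₂) - V (x + ((k : ℝ) + 1) • e₂)‖ * ‖V (x + (k : ℝ) • e₂) - V (x + ((k : ℝ) + 1) • e₂)‖ ≤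
          (‖V (x + (k : ℝ) • e₂)‖ + ‖V (x + ((k : ℝ) + 1) • e₂)‖) * (‖V (x + (k : ℝ) • e₂)‖ + ‖V (x + ((k : ℝ) + 1) • e₂)‖) :=
        mul_self_le_mul_self (norm_nonneg _) (norm_sub_le _ _)
      have hH := hH0 (x 2 - s₀)
      nlinarith [h1, sq_nonneg (‖V (x + (k : ℝ) • e₂)‖ - ‖V (x + ((k : ℝ) + 1) • e₂)‖), hH,
        mul_nonneg hH (sq_nonneg (‖V (x + (k : ℝ) • e₂)‖ - ‖V (x + ((k : ℝ) + 1) • e₂)‖))]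
    have iAB : Integrable (fun x => H' (x 2 - s₀) * ⟪V x, V (x + (k : ℝ) • e₂) - V (x + ((k : ℝ) + 1) • e₂)⟫) volume := by
      have h := ((iP 0 k).sub (iP 0 ((k : ℝ) + 1)))
      refine h.congr (Eventually.of_forall fun x => ?_)
      simp only [Pi.sub_apply, hV0, inner_sub_right]
      ring
    have hA : (∫ x, H' (x 2 - s₀) * ‖V x‖ ^ 2) = E₀ := by have := hW 0; simp_rw [hV0] at this; exact this
    by_cases hk : a k = 0
    · -- degenerate step: the pairing vanishes
      rw [hk, zero_mul, zero_div]
      refine le_of_forall_pos_le_add fun η hη => ?_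
      have hμ : 0 < η / E₀ := by positivity
      have h := abs_integral_window_inner_le (fun x => hH0 (x 2 - s₀)) hμ iA iB iAB
      have hB0 : (∫ x, H' (x 2 - s₀) * ‖V (x + (k : ℝ) • e₂) - V (x + ((k : ℝ) + 1) • e₂)‖ ^ 2) ≤ 0 := by
        have := hstep k; rw [hk] at this; simpa using this
      have hB0' : 0 ≤ ∫ x, H' (x 2 - s₀) * ‖V (x + (k : ℝ) • e₂) - V (x + ((k : ℝ) + 1) • e₂)‖ ^ 2 :=
        integral_nonneg fun x => mul_nonneg (hH0 _) (sq_nonneg _)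
      rw [hA, le_antisymm hB0 hB0', mul_zero, add_zero] at h
      calc |∫ x, H' (x 2 - s₀) * ⟪V x, V (x + (k : ℝ) • e₂) - V (x + ((k : ℝ) + 1) • e₂)⟫| ≤ η / E₀ / 2 * E₀ := h
        _ = η / 2 := by field_simp
        _ ≤ 0 + η := by linarith
    · have hapos : 0 < a k := lt_of_le_of_ne (ha0 k) (Ne.symm hk)
      have h := abs_integral_window_inner_le (fun x => hH0 (x 2 - s₀)) hapos iA iB iAB
      rw [hA] at h
      have h2 : 1 / (2 * a k) * (∫ x, H' (x 2 - s₀) * ‖V (x + (k : ℝ) • e₂) - V (x + ((k : ℝ) + 1) • e₂)‖ ^ 2) ≤ a k / 2 := by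
        calc 1 / (2 * a k) * (∫ x, H' (x 2 - s₀) * ‖V (x + (k : ℝ) • e₂) - V (x + ((k : ℝ) + 1) • e₂)‖ ^ 2)
            ≤ 1 / (2 * a k) * (a k) ^ 2 := mul_le_mul_of_nonneg_left (hstep k) (by positivity)
          _ = a k / 2 := by field_simp
      calc |∫ x, H' (x 2 - s₀) * ⟪V x, V (x + (k : ℝ) • e₂) - V (x + ((k : ℝ) + 1) • e₂)⟫|
          ≤ a k / 2 * E₀ + a k / 2 := by linarith
        _ = a k * (E₀ + 1) / 2 := by ring
  have hT1 : ∀ N : ℕ, |∫ x, H' (x 2 - s₀) * ⟪V x, V x - V (x + (N : ℝ) • e₂)⟫| ≤ E₀ / 8 := by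
    intro N
    have htel : ∀ x : EuclideanSpace ℝ (Fin 3), V x - V (x + (N : ℝ) • e₂) =
        ∑ k ∈ Finset.range N, (V (x + (k : ℝ) • e₂) - V (x + ((k : ℝ) + 1) • e₂)) := by
      intro x
      have h := Finset.sum_range_sub' (fun k : ℕ => V (x + (k : ℝ) • e₂)) N
      simp only [Nat.cast_zero, zero_smul, add_zero] at h
      rw [h.symm]
      refine Finset.sum_congr rfl fun k _ => ?_
      push_cast; rfl
    have e : (fun x => H' (x 2 - s₀) * ⟪V x, V x - V (x + (N : ℝ) • e₂)⟫) =
        fun x => ∑ k ∈ Finset.range N, H' (x 2 - s₀) * ⟪V x, V (x + (k : ℝ) • e₂) - V (x + ((k : ℝ) + 1) • e₂)⟫ := by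
      funext x; rw [htel, inner_sum, Finset.mul_sum]
    have iAB : ∀ k : ℕ, Integrable (fun x => H' (x 2 - s₀) * ⟪V x, V (x + (k : ℝ) • e₂) - V (x + ((k : ℝ) + 1) • e₂)⟫) volume := by
      intro k
      refine ((iP 0 k).sub (iP 0 ((k : ℝ) + 1))).congr (Eventually.of_forall fun x => ?_)
      simp only [Pi.sub_apply, hV0, inner_sub_right]
      ring
    rw [e, integral_finsetSum _ (fun k _ => iAB k)]
    calc |∑ k ∈ Finset.range N, ∫ x, H' (x 2 - s₀) * ⟪V x, V (x + (k : ℝ) • e₂) - V (x + ((k : ℝ) + 1) • e₂)⟫|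
        ≤ ∑ k ∈ Finset.range N, |∫ x, H' (x 2 - s₀) * ⟪V x, V (x + (k : ℝ) • e₂) - V (x + ((k : ℝ) + 1) • e₂)⟫| :=
          Finset.abs_sum_le_sum_abs _ _
      _ ≤ ∑ k ∈ Finset.range N, a k * (E₀ + 1) / 2 := Finset.sum_le_sum fun k _ => hpair k
      _ = (E₀ + 1) / 2 * ∑ k ∈ Finset.range N, a k := by rw [Finset.mul_sum]; refine Finset.sum_congr rfl fun k _ => by ring
      _ ≤ (E₀ + 1) / 2 * ∑' k, a k := by
          gcongr
          exact hsum.sum_le_tsum (Finset.range N) (fun k _ => ha0 k)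
      _ ≤ (E₀ + 1) / 2 * (E₀ / (4 * (E₀ + 1))) := by gcongr
      _ = E₀ / 8 := by field_simp; ring
  have iA : Integrable (fun x => H' (x 2 - s₀) * ‖V x‖ ^ 2) volume := by
    have := iW 0; simp_rw [hV0] at this; exact this
  have htail := tendsto_integral_indicator_compl_closedBall iA
  obtain ⟨n₀, hn₀⟩ := Filter.eventually_atTop.1 (Metric.tendsto_nhds.1 htail (E₀ / 16) (by positivity))
  have htail' : |∫ x, (closedBall (0 : EuclideanSpace ℝ (Fin 3)) n₀)ᶜ.indicator (fun x => H' (x 2 - s₀) * ‖V x‖ ^ 2) x| < E₀ / 16 := by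
    have := hn₀ n₀ le_rfl
    rwa [Real.dist_eq, sub_zero] at this
  set Bn : Set (EuclideanSpace ℝ (Fin 3)) := closedBall (0 : EuclideanSpace ℝ (Fin 3)) n₀ with hBn
  have hBmeas : MeasurableSet Bn := measurableSet_closedBall
  have hBvol : volume Bn < ⊤ := measure_closedBall_lt_top
  set Q : ℝ := D * Cv * (volume Bn).toReal + 1 with hQ
  have hQpos : 0 < Q := by positivity
  set η : ℝ := E₀ / (8 * Q) with hη
  have hηpos : 0 < η := by positivity
  have h1 : ∀ᶠ y in cocompact (EuclideanSpace ℝ (Fin 3)), dist (V y) 0 < η := Metric.tendsto_nhds.1 hfar η hηpos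
  rw [← Metric.cobounded_eq_cocompact] at h1
  obtain ⟨R₁, -, hR₁⟩ := (Metric.hasBasis_cobounded_compl_closedBall (0 : EuclideanSpace ℝ (Fin 3))).eventually_iff.1 h1
  have hfarV : ∀ y : EuclideanSpace ℝ (Fin 3), R₁ < ‖y‖ → ‖V y‖ < η := fun y hy => by
    have := hR₁ (show y ∈ (closedBall (0 : EuclideanSpace ℝ (Fin 3)) R₁)ᶜ by
      rw [mem_compl_iff, mem_closedBall, dist_zero_right, not_le]; exact hy)
    rwa [dist_zero_right] at this
  obtain ⟨N, hN⟩ := exists_nat_gt (R₁ + n₀)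
  have hT2 : |∫ x, H' (x 2 - s₀) * ⟪V x, V (x + (N : ℝ) • e₂)⟫| ≤ 3 * E₀ / 8 := by
    have iVN := iW N
    have hpt : ∀ x, |H' (x 2 - s₀) * ⟪V x, V (x + (N : ℝ) • e₂)⟫| ≤
        D * Cv * η * Bn.indicator (fun _ => (1 : ℝ)) x +
          (2 * Bnᶜ.indicator (fun x => H' (x 2 - s₀) * ‖V x‖ ^ 2) x + 1 / 8 * (H' (x 2 - s₀) * ‖V (x + (N : ℝ) • e₂)‖ ^ 2)) := by
      intro x
      rw [abs_mul, abs_of_nonneg (hH0 _)]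
      have hin := abs_real_inner_le_norm (V x) (V (x + (N : ℝ) • e₂))
      by_cases hx : x ∈ Bn
      · -- on the ball: the translate is far
        rw [indicator_of_mem hx, indicator_of_notMem (show x ∉ Bnᶜ from fun h' => h' hx), mul_one, mul_zero, zero_add]
        have hxn : ‖x‖ ≤ n₀ := by rwa [hBn, mem_closedBall, dist_zero_right] at hx
        have hfarx : R₁ < ‖x + (N : ℝ) • e₂‖ := by
          have h1 : ‖(N : ℝ) • e₂‖ = N := by rw [norm_smul, hne, mul_one, Real.norm_eq_abs, abs_of_nonneg (Nat.cast_nonneg N)]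
          have h2 : ‖(N : ℝ) • e₂‖ ≤ ‖x + (N : ℝ) • e₂‖ + ‖x‖ := by
            have := norm_sub_le (x + (N : ℝ) • e₂) x; rwa [add_sub_cancel_left] at this
          linarith
        have hVfar := (hfarV _ hfarx).le
        calc H' (x 2 - s₀) * |⟪V x, V (x + (N : ℝ) • e₂)⟫| ≤ D * (Cv * η) := by
              refine mul_le_mul (hHD _) (hin.trans (mul_le_mul (hVb x) hVfar (norm_nonneg _) hCv)) (abs_nonneg _) hD0
          _ ≤ D * Cv * η + 1 / 8 * (H' (x 2 - s₀) * ‖V (x + (N : ℝ) • e₂)‖ ^ 2) := by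
              have : 0 ≤ 1 / 8 * (H' (x 2 - s₀) * ‖V (x + (N : ℝ) • e₂)‖ ^ 2) := by
                have := hH0 (x 2 - s₀); positivity
              linarith
      · -- off the ball: Young with `λ = 4`
        rw [indicator_of_notMem hx, indicator_of_mem (show x ∈ Bnᶜ from hx), mul_zero, zero_add]
        have hy : ‖V x‖ * ‖V (x + (N : ℝ) • e₂)‖ ≤ 2 * ‖V x‖ ^ 2 + 1 / 8 * ‖V (x + (N : ℝ) • e₂)‖ ^ 2 := by
          nlinarith [sq_nonneg (4 * ‖V x‖ - ‖V (x + (N : ℝ) • e₂)‖)]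
        calc H' (x 2 - s₀) * |⟪V x, V (x + (N : ℝ) • e₂)⟫| ≤ H' (x 2 - s₀) * (2 * ‖V x‖ ^ 2 + 1 / 8 * ‖V (x + (N : ℝ) • e₂)‖ ^ 2) :=
              mul_le_mul_of_nonneg_left (hin.trans hy) (hH0 _)
          _ = 2 * (H' (x 2 - s₀) * ‖V x‖ ^ 2) + 1 / 8 * (H' (x 2 - s₀) * ‖V (x + (N : ℝ) • e₂)‖ ^ 2) := by ring
    have iInd : Integrable (fun x => D * Cv * η * Bn.indicator (fun _ => (1 : ℝ)) x) volume :=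
      ((integrable_indicator_iff hBmeas).2 (integrableOn_const hBvol.ne)).const_mul _
    have iTail : Integrable (fun x => Bnᶜ.indicator (fun x => H' (x 2 - s₀) * ‖V x‖ ^ 2) x) volume :=
      iA.indicator hBmeas.compl
    have i2 : Integrable (fun x => 2 * Bnᶜ.indicator (fun x => H' (x 2 - s₀) * ‖V x‖ ^ 2) x) volume := iTail.const_mul 2
    have i3 : Integrable (fun x => 1 / 8 * (H' (x 2 - s₀) * ‖V (x + (N : ℝ) • e₂)‖ ^ 2)) volume := iVN.const_mul _
    have i23 : Integrable (fun x => 2 * Bnᶜ.indicator (fun x => H' (x 2 - s₀) * ‖V x‖ ^ 2) x +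
        1 / 8 * (H' (x 2 - s₀) * ‖V (x + (N : ℝ) • e₂)‖ ^ 2)) volume := i2.add i3
    have iR : Integrable (fun x => D * Cv * η * Bn.indicator (fun _ => (1 : ℝ)) x +
        (2 * Bnᶜ.indicator (fun x => H' (x 2 - s₀) * ‖V x‖ ^ 2) x + 1 / 8 * (H' (x 2 - s₀) * ‖V (x + (N : ℝ) • e₂)‖ ^ 2))) volume :=
      iInd.add i23
    have iVN2 : Integrable (fun x => H' (x 2 - s₀) * ⟪V x, V (x + (N : ℝ) • e₂)⟫) volume :=
      (iP 0 N).congr (Eventually.of_forall fun x => by simp only [hV0])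
    have hle := (abs_integral_le_integral_abs (f := fun x => H' (x 2 - s₀) * ⟪V x, V (x + (N : ℝ) • e₂)⟫)).trans
      (integral_mono iVN2.abs iR hpt)
    have hR : (∫ x, (D * Cv * η * Bn.indicator (fun _ => (1 : ℝ)) x +
        (2 * Bnᶜ.indicator (fun x => H' (x 2 - s₀) * ‖V x‖ ^ 2) x + 1 / 8 * (H' (x 2 - s₀) * ‖V (x + (N : ℝ) • e₂)‖ ^ 2)))) =
        D * Cv * η * (volume Bn).toReal +
          (2 * (∫ x, Bnᶜ.indicator (fun x => H' (x 2 - s₀) * ‖V x‖ ^ 2) x) + 1 / 8 * E₀) := by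
      rw [integral_add iInd i23, integral_add i2 i3, integral_const_mul, integral_const_mul, integral_const_mul, hW N,
        integral_indicator_const _ hBmeas, smul_eq_mul, mul_one]
      rfl
    rw [hR] at hle
    have hball : D * Cv * η * (volume Bn).toReal ≤ E₀ / 8 := by
      have : D * Cv * (volume Bn).toReal ≤ Q := by rw [hQ]; linarith
      calc D * Cv * η * (volume Bn).toReal = η * (D * Cv * (volume Bn).toReal) := by ring
        _ ≤ η * Q := mul_le_mul_of_nonneg_left this hηpos.le
        _ = E₀ / 8 := by rw [hη]; field_simp
    have htl : 2 * (∫ x, Bnᶜ.indicator (fun x => H' (x 2 - s₀) * ‖V x‖ ^ 2) x) ≤ E₀ / 8 := by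
      have := (le_abs_self _).trans htail'.le
      linarith
    linarith
  have hsplit : E₀ = (∫ x, H' (x 2 - s₀) * ⟪V x, V x - V (x + (N : ℝ) • e₂)⟫) +
      ∫ x, H' (x 2 - s₀) * ⟪V x, V (x + (N : ℝ) • e₂)⟫ := by
    have i1 : Integrable (fun x => H' (x 2 - s₀) * ⟪V x, V x - V (x + (N : ℝ) • e₂)⟫) volume := by
      refine ((iP 0 0).sub (iP 0 N)).congr (Eventually.of_forall fun x => ?_)
      simp only [Pi.sub_apply, hV0, inner_sub_right]; ring
    have i2 : Integrable (fun x => H' (x 2 - s₀) * ⟪V x, V (x + (N : ℝ) • e₂)⟫) volume :=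
      (iP 0 N).congr (Eventually.of_forall fun x => by simp only [hV0])
    have hA0 : (∫ x, H' (x 2 - s₀) * ‖V x‖ ^ 2) = E₀ := by have := hW 0; simp_rw [hV0] at this; exact this
    rw [← integral_add i1 i2, ← hA0]
    refine integral_congr_ae (Eventually.of_forall fun x => ?_)
    dsimp only
    rw [← mul_add, ← inner_add_right, sub_add_cancel, real_inner_self_eq_norm_sq]
  have h1' := (le_abs_self _).trans (hT1 N)
  have h2' := (le_abs_self _).trans hT2
  linarith

end ExtremiserLiouville

end Summit.NavierStokesRegularity.NavierStokesRegularity.Theorems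

end
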